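import Summits.AtomisticToContinuum.BoseEinsteinCondensation.Theses.BECHeatBathGap
import Summits.AtomisticToContinuum.BoseEinsteinCondensation.Theorems.BECInsertionCorrectorDirichletRemovalBound
import Literature.MathematicalPhysics.QuantumManyBody.CoulombBoxIntegrability
import Literature.MathematicalPhysics.QuantumManyBody.PeriodicBoseGasPQ
import HarnessLib

/-!
# Route `BECHeatBathGap`, support item `SomeNearMinimiserCondenses` (stmt-AtomisticToContinuum-14369):
# reduction to the cruxes (`TensorisedIncrement`, stmt-AtomisticToContinuum-14370)

`SomeNearMinimiserCondenses` — for every repulsive finite-range `v`, small `ρ` and all large `N`, at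
every slack `δ > 0` SOME `δ`-near-minimiser `Ψ` of the `(N+1)`-body Dirichlet energy in the box of
side `((N+1)/ρ)^{1/3}` has `λ_max(γ_Ψ) ≥ c (N+1)` — is, as a standalone statement, Bose–Einstein
condensation for the dilute interacting gas (open). Inside the route it is the typed junction
between the two cruxes `ParticleTensorisation` (A1: approximate tensorisation of `|Θ_N|²` over
particle labels with constant `C`) and `SquareSummableInfluence` (A2: total squared one-particle
influence `≤ ε` on the insertion amplitude) and the proved support `DirichletRemovalBound`
(stmt-AtomisticToContinuum-12061). This file proves that junction:

* `someNearMinimiserCondenses_of_tensorisation :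
    ParticleTensorisation → SquareSummableInfluence → SomeNearMinimiserCondenses` (with `c = 3/4`),
* `tensorisedIncrement_proof : TensorisedIncrement` — the route decl of
  stmt-AtomisticToContinuum-14370 (`A1 → A2 → DirichletRemovalBound → SomeNearMinimiserCondenses`),
  an immediate corollary since `DirichletRemovalBound` is a theorem
  (`heatBathGap_dirichletRemovalBound_proof`).

Proof ([EfronStein1981] tensorisation step; [PenroseOnsager1956] criterion). With `C` from A1 take
`ε = 1/(4C)` in A2 and `ρ₀ = min` of the two thresholds. For large `N` let `δ₂` be A2's slack,
`Θ` A1's witness at slack `δ₂`, and for `δ > 0` let `Ψ, g` be A2's witness for `Θ`. For every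
`y` apply A1 to the fibre `F_y = Ψ(y, ·)` with the predictors `g_i(y, ·)` (bounded, measurable,
`x_i`-independent by `Fin.cons_update`), and compare with the projection onto the unit vector `Θ`
(`lintegral_sq_le_sq_removal_add_lintegral_sub`, the `L²` inequality
`‖F‖² ≤ |⟨Θ, F⟩|² + ‖F - cΘ‖²`): `∫|F_y|² ≤ |m(y)|² + C Σᵢ ∫_{Λ^N} |F_y - g_i(y,·) Θ|²` with
`m(y) = ∫ conj Θ(X) Ψ(y, X) dX`. Integrating over `y ∈ Λ` (Tonelli; `(y, X) ↦ (y, X)` is volume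
preserving and maps `Λ × Λ^N` onto `Λ^{N+1}`, `setLIntegral_box_boxN_vecCons`) gives
`1 ≤ ∫|m|² + C ε = ∫|m|² + 1/4`, and `DirichletRemovalBound` turns `∫|m|² ≥ 3/4` into
`λ_max(γ_Ψ) ≥ (3/4)(N+1)`.
-/

noncomputable section

open MeasureTheory
open scoped ENNReal NNReal ComplexConjugate InnerProductSpace

namespace Summit.AtomisticToContinuum.BoseEinsteinCondensation.Theorems

open Literature.MathematicalPhysics.QuantumManyBody.BoseGas

/-! ### The `L²` projection inequality -/

/-- In a complex inner product space, for a unit vector `θ` and any scalar `c`: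
`‖f‖² ≤ |⟨θ, f⟩|² + ‖f - c θ‖²` (the distance to the line `ℂ θ` is attained at `c = ⟨θ, f⟩`,
where Pythagoras gives equality). [folklore] -/
theorem norm_sq_le_norm_inner_sq_add_norm_sub_smul_sq {E : Type*} [NormedAddCommGroup E]
    [InnerProductSpace ℂ E] (θ f : E) (hθ : ‖θ‖ = 1) (c : ℂ) :
    ‖f‖ ^ 2 ≤ ‖⟪θ, f⟫_ℂ‖ ^ 2 + ‖f - c • θ‖ ^ 2 := by
  set a : ℂ := ⟪θ, f⟫_ℂ with ha
  have h1 : ‖f - c • θ‖ ^ 2 = ‖f‖ ^ 2 - 2 * RCLike.re ⟪f, c • θ⟫_ℂ + ‖c • θ‖ ^ 2 :=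
    norm_sub_sq (𝕜 := ℂ) f (c • θ)
  have h2 : ⟪f, c • θ⟫_ℂ = c * conj a := by
    rw [inner_smul_right, ha, inner_conj_symm]
  have h3 : ‖c • θ‖ = ‖c‖ := by rw [norm_smul, hθ, mul_one]
  have h4 : ‖a - c‖ ^ 2 = ‖a‖ ^ 2 - 2 * RCLike.re ⟪a, c⟫_ℂ + ‖c‖ ^ 2 := norm_sub_sq (𝕜 := ℂ) a c
  have h5 : ⟪a, c⟫_ℂ = c * conj a := by rw [RCLike.inner_apply', mul_comm]
  rw [h2, h3] at h1
  rw [h5] at h4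
  nlinarith [sq_nonneg ‖a - c‖, h1, h4]

/-- `‖[F]‖_{L²}² = (∫⁻ ‖F‖²).toReal` for the class of `F` in `L²`. [folklore] -/
theorem norm_toLp_sq_eq_toReal_lintegral {α : Type*} [MeasurableSpace α] {μ : Measure α}
    {F : α → ℂ} (hF : MemLp F 2 μ) :
    ‖hF.toLp F‖ ^ 2 = (∫⁻ x, (‖F x‖₊ : ℝ≥0∞) ^ 2 ∂μ).toReal := by
  rw [@norm_sq_eq_re_inner ℂ, MeasureTheory.L2.inner_def, MeasureTheory.L2.integral_inner_eq_sq_eLpNorm,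
    RCLike.ofReal_re]
  congr 1
  refine lintegral_congr_ae ?_
  filter_upwards [hF.coeFn_toLp] with x hx
  rw [hx, ENNReal.rpow_two]

/-- `⟪[G], [F]⟫_{L²} = ∫ conj G · F` for `F, G ∈ L²`. [folklore] -/
theorem inner_toLp_eq_integral_conj_mul {α : Type*} [MeasurableSpace α] {μ : Measure α}
    {F G : α → ℂ} (hF : MemLp F 2 μ) (hG : MemLp G 2 μ) :
    ⟪hG.toLp G, hF.toLp F⟫_ℂ = ∫ x, conj (G x) * F x ∂μ := by
  rw [MeasureTheory.L2.inner_def]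
  refine integral_congr_ae ?_
  filter_upwards [hF.coeFn_toLp, hG.coeFn_toLp] with x hF' hG'
  rw [hF', hG', RCLike.inner_apply']

/-- **Projection inequality, `ℝ≥0∞` form.** For `F ∈ L²` and a unit vector `Θ` (`∫|Θ|² = 1`),
`∫ |F|² ≤ |∫ conj Θ · F|² + ∫ |F - c Θ|²` for every `c ∈ ℂ`. [folklore] -/
theorem lintegral_sq_le_sq_removal_add_lintegral_sub {α : Type*} [MeasurableSpace α] {μ : Measure α}
    {F Θ : α → ℂ} (hF : AEStronglyMeasurable F μ) (hΘ : AEStronglyMeasurable Θ μ)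
    (hFfin : ∫⁻ x, (‖F x‖₊ : ℝ≥0∞) ^ 2 ∂μ ≠ ⊤) (hΘ1 : ∫⁻ x, (‖Θ x‖₊ : ℝ≥0∞) ^ 2 ∂μ = 1) (c : ℂ) :
    ∫⁻ x, (‖F x‖₊ : ℝ≥0∞) ^ 2 ∂μ ≤
      (‖∫ x, conj (Θ x) * F x ∂μ‖₊ : ℝ≥0∞) ^ 2 + ∫⁻ x, (‖F x - c * Θ x‖₊ : ℝ≥0∞) ^ 2 ∂μ := by
  have hF2 : MemLp F 2 μ := memLp_two_of_lintegral_ne_top hF hFfin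
  have hΘ2 : MemLp Θ 2 μ :=
    memLp_two_of_lintegral_ne_top hΘ (by rw [hΘ1]; exact ENNReal.one_ne_top)
  have hD2 : MemLp (F - c • Θ) 2 μ := hF2.sub (hΘ2.const_smul c)
  have hθ : ‖hΘ2.toLp Θ‖ = 1 := by
    have h := norm_toLp_sq_eq_toReal_lintegral hΘ2
    rw [hΘ1, ENNReal.toReal_one] at h
    have h0 : 0 ≤ ‖hΘ2.toLp Θ‖ := norm_nonneg _
    nlinarith [h, h0]
  have key := norm_sq_le_norm_inner_sq_add_norm_sub_smul_sq (hΘ2.toLp Θ) (hF2.toLp F) hθ c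
  rw [inner_toLp_eq_integral_conj_mul hF2 hΘ2, norm_toLp_sq_eq_toReal_lintegral hF2,
    ← MemLp.toLp_const_smul, ← MemLp.toLp_sub, norm_toLp_sq_eq_toReal_lintegral hD2] at key
  have hsub : ∫⁻ x, (‖(F - c • Θ) x‖₊ : ℝ≥0∞) ^ 2 ∂μ = ∫⁻ x, (‖F x - c * Θ x‖₊ : ℝ≥0∞) ^ 2 ∂μ := by
    simp only [Pi.sub_apply, Pi.smul_apply, smul_eq_mul]
  rw [hsub] at key
  set A := ∫⁻ x, (‖F x‖₊ : ℝ≥0∞) ^ 2 ∂μ with hA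
  set T := ∫⁻ x, (‖F x - c * Θ x‖₊ : ℝ≥0∞) ^ 2 ∂μ with hT
  set a := ∫ x, conj (Θ x) * F x ∂μ with ha
  calc A = ENNReal.ofReal A.toReal := (ENNReal.ofReal_toReal hFfin).symm
    _ ≤ ENNReal.ofReal (‖a‖ ^ 2 + T.toReal) := ENNReal.ofReal_le_ofReal key
    _ = ENNReal.ofReal (‖a‖ ^ 2) + ENNReal.ofReal T.toReal :=
        ENNReal.ofReal_add (by positivity) ENNReal.toReal_nonneg
    _ ≤ (‖a‖₊ : ℝ≥0∞) ^ 2 + T := by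
        rw [← coe_nnnorm_sq_eq_ofReal]
        exact add_le_add le_rfl ENNReal.ofReal_toReal_le

/-! ### Tonelli over the boxes `Λ × Λ^N ≅ Λ^{N+1}` -/

/-- `(y, X) ∈ Λ_L^{n+1}` iff `y ∈ Λ_L` and `X ∈ Λ_L^n`. [folklore] -/
theorem vecCons_mem_boxN_succ_iff {n : ℕ} {L : ℝ} {y : Space} {X : Config n} :
    (Matrix.vecCons y X : Config (n + 1)) ∈ boxN (n + 1) L ↔ y ∈ box L ∧ X ∈ boxN n L := by
  simp only [boxN, Set.mem_setOf_eq, Fin.forall_fin_succ, Matrix.cons_val_zero,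
    Matrix.cons_val_succ]

/-- **Tonelli restricted to the boxes**: `∫_{Λ} (∫_{Λ^n} G(y, X) dX) dy = ∫_{Λ^{n+1}} G(Z) dZ` for
measurable `G ≥ 0` (prepending the first particle is volume preserving and maps `Λ × Λ^n` onto
`Λ^{n+1}`). [folklore] -/
theorem setLIntegral_box_boxN_vecCons {n : ℕ} (L : ℝ) {G : Config (n + 1) → ℝ≥0∞}
    (hG : Measurable G) :
    ∫⁻ y in box L, ∫⁻ X in boxN n L, G (Matrix.vecCons y X) = ∫⁻ Z in boxN (n + 1) L, G Z := by
  have hind : ∀ (y : Space) (X : Config n), (boxN (n + 1) L).indicator G (Matrix.vecCons y X) =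
      (box L).indicator (fun y' => (boxN n L).indicator (fun X' => G (Matrix.vecCons y' X')) X) y := by
    intro y X
    by_cases hy : y ∈ box L
    · by_cases hX : X ∈ boxN n L
      · rw [Set.indicator_of_mem (vecCons_mem_boxN_succ_iff.2 ⟨hy, hX⟩), Set.indicator_of_mem hy,
          Set.indicator_of_mem hX]
      · rw [Set.indicator_of_notMem (fun h => hX (vecCons_mem_boxN_succ_iff.1 h).2),
          Set.indicator_of_mem hy, Set.indicator_of_notMem hX]
    · rw [Set.indicator_of_notMem (fun h => hy (vecCons_mem_boxN_succ_iff.1 h).1),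
        Set.indicator_of_notMem hy]
  calc ∫⁻ y in box L, ∫⁻ X in boxN n L, G (Matrix.vecCons y X)
      = ∫⁻ y, (box L).indicator (fun y' => ∫⁻ X in boxN n L, G (Matrix.vecCons y' X)) y :=
        (lintegral_indicator (measurableSet_box L) _).symm
    _ = ∫⁻ y, ∫⁻ X, (boxN (n + 1) L).indicator G (Matrix.vecCons y X) := by
        refine lintegral_congr fun y => ?_
        by_cases hy : y ∈ box L
        · rw [Set.indicator_of_mem hy, ← lintegral_indicator (measurableSet_boxN n L)]
          refine lintegral_congr fun X => ?_
          rw [hind, Set.indicator_of_mem hy]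
        · rw [Set.indicator_of_notMem hy]
          have h0 : ∀ X, (boxN (n + 1) L).indicator G (Matrix.vecCons y X) = 0 := fun X => by
            rw [hind, Set.indicator_of_notMem hy]
          simp only [h0, lintegral_zero]
    _ = ∫⁻ Z, (boxN (n + 1) L).indicator G Z :=
        lintegral_lintegral_vecCons (hG.indicator (measurableSet_boxN _ _))
    _ = ∫⁻ Z in boxN (n + 1) L, G Z := lintegral_indicator (measurableSet_boxN _ _) _

/-! ### The reduction -/

/-- **`ParticleTensorisation → SquareSummableInfluence → SomeNearMinimiserCondenses`** (card A3 of
route `BECHeatBathGap`, with `c = 3/4`): fibrewise approximate tensorisation against the unit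
vector `Θ`, Tonelli over `Λ × Λ^N ≅ Λ^{N+1}`, and the removal bound `DirichletRemovalBound`
(proved, stmt-AtomisticToContinuum-12061); the tensorisation step of [EfronStein1981] combined with the
[PenroseOnsager1956] criterion, as in the route's card A3. [folklore] -/
theorem someNearMinimiserCondenses_of_tensorisation
    (h1 : Summit.AtomisticToContinuum.BoseEinsteinCondensation.Theses.BECHeatBathGap.ParticleTensorisation)
    (h2 : Summit.AtomisticToContinuum.BoseEinsteinCondensation.Theses.BECHeatBathGap.SquareSummableInfluence) :
    Summit.AtomisticToContinuum.BoseEinsteinCondensation.Theses.BECHeatBathGap.SomeNearMinimiserCondenses := by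
  intro v hv
  obtain ⟨ρ₁, hρ₁, C, hC, H1⟩ := h1 v hv
  have hε : (0 : ℝ) < 1 / (4 * C) := by positivity
  obtain ⟨ρ₂, hρ₂, H2⟩ := h2 v hv (1 / (4 * C)) hε
  refine ⟨min ρ₁ ρ₂, lt_min hρ₁ hρ₂, fun ρ hρ hρlt => ⟨3 / 4, by norm_num, ?_⟩⟩
  filter_upwards [H1 ρ hρ (hρlt.trans_le (min_le_left _ _)),
    H2 ρ hρ (hρlt.trans_le (min_le_right _ _))] with N hN1 hN2
  intro δ hδ
  -- the side length is fixed from now on; call it `L`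
  generalize sideLength ρ (N + 1) = L at hN1 hN2 ⊢
  obtain ⟨δ₂, hδ₂, hΘall⟩ := hN2
  obtain ⟨Θ, hΘE, hAT⟩ := hN1 δ₂ hδ₂
  obtain ⟨Ψ, hΨE, g, hgm, ⟨M, hM⟩, hupd, hI⟩ := hΘall Θ hΘE δ hδ
  refine ⟨Ψ, hΨE, ?_⟩
  have hΨm : Measurable Ψ.ψ := Ψ.contDiff.continuous.measurable
  have hΘm : Measurable Θ.ψ := Θ.contDiff.continuous.measurable
  obtain ⟨B, hB⟩ := Literature.MathematicalPhysics.QuantumManyBody.JelliumBoseGas.trialState_exists_norm_le Ψ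
  -- the removal amplitude `m(y) = ∫ conj Θ(X) Ψ(y, X) dX` and `A = ∫ |m|²`
  set m : Space → ℂ := fun y => ∫ X, conj (Θ.ψ X) * Ψ.ψ (Matrix.vecCons y X) with hm
  have hmm : Measurable m := measurable_removalAmplitude hΨm hΘm
  set A : ℝ≥0∞ := ∫⁻ y, (‖m y‖₊ : ℝ≥0∞) ^ 2 with hA
  -- the influence integrands `G_i(Z) = |Ψ(Z) - g_i(Z) Θ(tail Z)|²`
  obtain ⟨Gi, hGi⟩ : ∃ Gi : Fin N → Config (N + 1) → ℝ≥0∞,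
      ∀ i Z, Gi i Z = (‖Ψ.ψ Z - g i Z * Θ.ψ (Matrix.vecTail Z)‖₊ : ℝ≥0∞) ^ 2 := ⟨_, fun _ _ => rfl⟩
  have hGim : ∀ i, Measurable (Gi i) := fun i => by
    rw [show Gi i = fun Z => (‖Ψ.ψ Z - g i Z * Θ.ψ (Matrix.vecTail Z)‖₊ : ℝ≥0∞) ^ 2 from
      funext (hGi i)]
    exact (hΨm.sub ((hgm i).mul (hΘm.comp measurable_vecTail))).nnnorm.coe_nnreal_ennreal.pow_const 2
  -- the fibre bound `b_i(y) = ∫_{Λ^N} G_i(y, X) dX` is measurable in `y`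
  have hbm : ∀ i, Measurable fun y : Space => ∫⁻ X in boxN N L, Gi i (Matrix.vecCons y X) :=
    fun i => ((hGim i).comp measurable_vecCons).lintegral_prod_right'
      (ν := (volume : Measure (Config N)).restrict (boxN N L))
  /- (1) fibrewise: for every `y`,
     `∫ |Ψ(y,·)|² ≤ |m(y)|² + C Σᵢ ∫_{Λ^N} G_i(y, ·)`. -/
  have hfibre : ∀ y : Space, ∫⁻ X, (‖Ψ.ψ (Matrix.vecCons y X)‖₊ : ℝ≥0∞) ^ 2 ≤
      (‖m y‖₊ : ℝ≥0∞) ^ 2 +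
        ENNReal.ofReal C * ∑ i : Fin N, ∫⁻ X in boxN N L, Gi i (Matrix.vecCons y X) := by
    intro y
    -- the fibre and the fibred predictors
    set F : Config N → ℂ := fun X => Ψ.ψ (Matrix.vecCons y X) with hF
    have hFm : Measurable F := hΨm.comp (measurable_vecCons_right y)
    have hFc : Continuous F := Ψ.contDiff.continuous.comp (continuous_const.matrixVecCons continuous_id)
    have hF0 : ∀ X, X ∉ boxN N L → F X = 0 := fun X hX =>
      Ψ.eq_zero _ fun h => hX (vecCons_mem_boxN_succ_iff.1 h).2
    obtain ⟨c, hc⟩ := hAT F (fun i X => g i (Matrix.vecCons y X)) hFm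
      (fun i => (hgm i).comp (measurable_vecCons_right y))
      ⟨max B M, fun X => ⟨(hB _).trans (le_max_left _ _), fun i => (hM i _).trans (le_max_right _ _)⟩⟩
      (fun i X x => by
        have hcu : (Matrix.vecCons y (Function.update X i x) : Config (N + 1)) =
            Function.update (Matrix.vecCons y X) i.succ x :=
          Fin.cons_update (α := fun _ : Fin (N + 1) => Space) y X i x
        simp only [hcu, hupd])
    -- the right-hand side of A1 in terms of the `G_i`
    have hcG : ∫⁻ X in boxN N L, (‖F X - c * Θ.ψ X‖₊ : ℝ≥0∞) ^ 2 ≤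
        ENNReal.ofReal C * ∑ i : Fin N, ∫⁻ X in boxN N L, Gi i (Matrix.vecCons y X) := by
      refine hc.trans (le_of_eq ?_)
      congr 1
      refine Finset.sum_congr rfl fun i _ => lintegral_congr fun X => ?_
      simp only [hGi, Matrix.tail_cons, hF]
    -- finiteness of `∫ |F|²` (continuous, supported in the bounded box)
    have hsuppF : Function.support (fun X => (‖F X‖₊ : ℝ≥0∞) ^ 2) ⊆ boxN N L := by
      intro X hX
      by_contra h
      exact hX (by simp [hF0 X h])
    have hFfin : ∫⁻ X, (‖F X‖₊ : ℝ≥0∞) ^ 2 ≠ ⊤ := by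
      rw [← setLIntegral_eq_of_support_subset hsuppF]
      exact (lintegral_boxN_normSq_lt_top hFc L).ne
    -- projection inequality against the unit vector `Θ`
    have hproj := lintegral_sq_le_sq_removal_add_lintegral_sub hFm.aestronglyMeasurable
      hΘm.aestronglyMeasurable hFfin Θ.norm_eq c
    -- `∫ |F - cΘ|² = ∫_{Λ^N} |F - cΘ|²`
    have hsuppD : Function.support (fun X => (‖F X - c * Θ.ψ X‖₊ : ℝ≥0∞) ^ 2) ⊆ boxN N L := by
      intro X hX
      by_contra h
      exact hX (by simp [hF0 X h, Θ.eq_zero X h])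
    rw [← setLIntegral_eq_of_support_subset hsuppD] at hproj
    exact hproj.trans (add_le_add le_rfl hcG)
  /- (2) integrate over `y ∈ Λ`: `1 ≤ A + C Σᵢ ∫_{Λ^{N+1}} G_i ≤ A + 1/4`. -/
  have hone : (1 : ℝ≥0∞) ≤ A + ENNReal.ofReal (1 / 4) := by
    -- `1 = ∫ |Ψ|² = ∫_Λ ∫ |Ψ(y, X)|² dX dy`
    have hsq : Measurable fun Z : Config (N + 1) => (‖Ψ.ψ Z‖₊ : ℝ≥0∞) ^ 2 :=
      hΨm.nnnorm.coe_nnreal_ennreal.pow_const 2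
    have hsupp : Function.support (fun y : Space => ∫⁻ X, (‖Ψ.ψ (Matrix.vecCons y X)‖₊ : ℝ≥0∞) ^ 2) ⊆
        box L := by
      intro y hy
      by_contra h
      have h0 : ∀ X : Config N, Ψ.ψ (Matrix.vecCons y X) = 0 := fun X =>
        Ψ.eq_zero _ fun h' => h (vecCons_mem_boxN_succ_iff.1 h').1
      exact hy (by simp [h0])
    have h1eq : (1 : ℝ≥0∞) = ∫⁻ y in box L, ∫⁻ X, (‖Ψ.ψ (Matrix.vecCons y X)‖₊ : ℝ≥0∞) ^ 2 := by
      rw [setLIntegral_eq_of_support_subset hsupp, lintegral_lintegral_vecCons hsq, Ψ.norm_eq]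
    -- the influence sum, reassembled on `Λ^{N+1}`
    have hsum : ∑ i : Fin N, ∫⁻ y in box L, ∫⁻ X in boxN N L, Gi i (Matrix.vecCons y X) ≤
        ENNReal.ofReal (1 / (4 * C)) := by
      calc ∑ i : Fin N, ∫⁻ y in box L, ∫⁻ X in boxN N L, Gi i (Matrix.vecCons y X)
          = ∑ i : Fin N, ∫⁻ Z in boxN (N + 1) L, Gi i Z :=
            Finset.sum_congr rfl fun i _ => setLIntegral_box_boxN_vecCons L (hGim i)
        _ ≤ ENNReal.ofReal (1 / (4 * C)) := by simpa only [hGi] using hI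
    calc (1 : ℝ≥0∞) = ∫⁻ y in box L, ∫⁻ X, (‖Ψ.ψ (Matrix.vecCons y X)‖₊ : ℝ≥0∞) ^ 2 := h1eq
      _ ≤ ∫⁻ y in box L, ((‖m y‖₊ : ℝ≥0∞) ^ 2 +
            ENNReal.ofReal C * ∑ i : Fin N, ∫⁻ X in boxN N L, Gi i (Matrix.vecCons y X)) :=
          lintegral_mono fun y => hfibre y
      _ = (∫⁻ y in box L, (‖m y‖₊ : ℝ≥0∞) ^ 2) +
            ∫⁻ y in box L, ENNReal.ofReal C *
              ∑ i : Fin N, ∫⁻ X in boxN N L, Gi i (Matrix.vecCons y X) :=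
          lintegral_add_left (hmm.nnnorm.coe_nnreal_ennreal.pow_const 2) _
      _ ≤ A + ENNReal.ofReal C *
            ∑ i : Fin N, ∫⁻ y in box L, ∫⁻ X in boxN N L, Gi i (Matrix.vecCons y X) := by
          refine add_le_add (setLIntegral_le_lintegral _ _) (le_of_eq ?_)
          rw [lintegral_const_mul' _ _ ENNReal.ofReal_ne_top,
            lintegral_finsetSum _ fun i _ => hbm i]
      _ ≤ A + ENNReal.ofReal C * ENNReal.ofReal (1 / (4 * C)) := by gcongr
      _ = A + ENNReal.ofReal (1 / 4) := by
          rw [← ENNReal.ofReal_mul hC.le]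
          congr 2
          field_simp
  /- (3) `A ≥ 3/4`, and the removal bound gives `λ_max ≥ (N+1) A ≥ (3/4)(N+1)`. -/
  have hA34 : ENNReal.ofReal (3 / 4) ≤ A := by
    rcases eq_or_ne A ⊤ with hAtop | hAtop
    · rw [hAtop]; exact le_top
    have h : (1 : ℝ≥0∞) ≤ ENNReal.ofReal (A.toReal + 1 / 4) := by
      rw [ENNReal.ofReal_add ENNReal.toReal_nonneg (by norm_num), ENNReal.ofReal_toReal hAtop]
      exact hone
    rw [← ENNReal.ofReal_one, ENNReal.ofReal_le_ofReal_iff (by positivity)] at h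
    calc ENNReal.ofReal (3 / 4) ≤ ENNReal.ofReal A.toReal := ENNReal.ofReal_le_ofReal (by linarith)
      _ = A := ENNReal.ofReal_toReal hAtop
  have hDRB := trialState_succ_mul_lintegral_sq_removal_le_maxOccupation Ψ Θ
  calc ENNReal.ofReal (3 / 4 * ((N : ℝ) + 1))
      = ENNReal.ofReal (3 / 4) * ((N : ℝ≥0∞) + 1) := by
        rw [ENNReal.ofReal_mul (by norm_num), show ((N : ℝ) + 1) = ((N + 1 : ℕ) : ℝ) by push_cast; ring,
          ENNReal.ofReal_natCast]
        push_cast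
        ring
    _ ≤ A * ((N : ℝ≥0∞) + 1) := by gcongr
    _ = ((N : ℝ≥0∞) + 1) * A := mul_comm _ _
    _ ≤ maxOccupation (N + 1) Ψ.ψ := hDRB

/-- **Item stmt-AtomisticToContinuum-14370** (`TensorisedIncrement` of route `BECHeatBathGap`):
`ParticleTensorisation → SquareSummableInfluence → DirichletRemovalBound →
SomeNearMinimiserCondenses`; the third hypothesis is not needed since `DirichletRemovalBound` is
proved (`heatBathGap_dirichletRemovalBound_proof`). [folklore] -/
theorem tensorisedIncrement_proof :
    Summit.AtomisticToContinuum.BoseEinsteinCondensation.Theses.BECHeatBathGap.TensorisedIncrement := by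
  unfold Summit.AtomisticToContinuum.BoseEinsteinCondensation.Theses.BECHeatBathGap.TensorisedIncrement
  intro h1 h2 _
  exact someNearMinimiserCondenses_of_tensorisation h1 h2

end Summit.AtomisticToContinuum.BoseEinsteinCondensation.Theorems

end
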